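import Summits.Ventures.Crystal3D.Theorems.StickyWulffConstantGenericWallFloorFramePropagationHcp
import HarnessLib

/-!
# Patch-to-patch transfer in physical space and the frame-class endgame
# (crux `GenericWallFloor`, line `WallLedgerG`)

HONEST FRAMING. Part of the venture `Summits/Ventures/Crystal3D` (cell `crystal3d-full`), helper
`--supports` the crux `GenericWallFloor` (stmt-Ventures-19480) of `route-Ventures-StickyWulffConstant`,
registered line `WallLedgerG` (planner cf-p1 gen 16), stub `stub_twoSlabAdhesion : TwoSlabAdhesion`.
Bookkeeping layer over `…FramePropagation` / `…FramePropagationHcp` / `…CoaxialCriterion`: the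
junction theorems there are stated in stacking coordinates (transition `q ↦ y₂ + M(q − y₁)`); a
prover meets rigid Barlow PATCHES `Pᵢ = (fun p => Lᵢ p + sᵢ) '' B(σᵢ)` in physical space sharing a
ball `X` whose `P₁`-contact shell lies in `P₂`.  This file does the translation once:

* `shell_transfer_of_patches` — the physical hypothesis gives the coordinate transfer hypothesis
  with `M = L₂⁻¹ ∘ L₁`;
* `patches_fccType_junction` — fcc-type shared shell: `L₁·B(σ₁ k₁) = L₂·B(σ₂ k₂)` (and the second
  site is fcc-type);
* `patches_hcpType_junction` — hcp-type shared shell: the second site is hcp-type and the frame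
  classes agree, `{L₁·Λ₀, L₁·Λ₀⁻} = {L₂·Λ₀, L₂·Λ₀⁻}`;
* `coaxial_of_frameClass_eq` — the endgame one step up: grain 1 captured by the class of `L₁`,
  grain 2 by the class of `L₂`, equal classes ⇒ the co-axiality `∃`-clause.

WHAT THIS IS NOT: the chain/areal argument producing such patches from a defect-poor filling;
rung F-C1 not moved.
-/

noncomputable section

namespace Summit.Ventures.Crystal3D.Theorems

open Literature.MathematicalPhysics.StatisticalMechanics

/-- **Physical shared shell ⇒ coordinate transfer.**  Two rigid Barlow patches
`Pᵢ = (fun p => Lᵢ p + sᵢ) '' B(σᵢ)` contain the ball `X = L₁ y₁ + s₁ = L₂ y₂ + s₂` (`yᵢ` sites), and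
every ball of `P₁` touching `X` lies in `P₂`.  Then `q ↦ y₂ + (L₂⁻¹ ∘ L₁)(q − y₁)` carries the
`B(σ₁)`-shell of `y₁` into `B(σ₂)`. -/
theorem shell_transfer_of_patches {σ₁ σ₂ : ℤ → ℤ}
    (L₁ L₂ : EuclideanSpace ℝ (Fin 3) ≃ₗᵢ[ℝ] EuclideanSpace ℝ (Fin 3)) (s₁ s₂ : EuclideanSpace ℝ (Fin 3))
    (y₁ y₂ : EuclideanSpace ℝ (Fin 3)) (hX : L₁ y₁ + s₁ = L₂ y₂ + s₂)
    (hshell : ∀ Q ∈ (fun p => L₁ p + s₁) '' barlowStacking 1 (Real.sqrt (2 / 3)) σ₁,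
      dist (L₁ y₁ + s₁) Q = 1 → Q ∈ (fun p => L₂ p + s₂) '' barlowStacking 1 (Real.sqrt (2 / 3)) σ₂) :
    ∀ q ∈ barlowStacking 1 (Real.sqrt (2 / 3)) σ₁, dist y₁ q = 1 →
      y₂ + (L₁.trans L₂.symm) (q - y₁) ∈ barlowStacking 1 (Real.sqrt (2 / 3)) σ₂ := by
  intro q hq hd
  have hQ : L₁ q + s₁ ∈ (fun p => L₂ p + s₂) '' barlowStacking 1 (Real.sqrt (2 / 3)) σ₂ := by
    refine hshell _ ⟨q, hq, rfl⟩ ?_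
    rw [dist_add_right, LinearIsometryEquiv.dist_map, hd]
  obtain ⟨q₂, hq₂, e⟩ := hQ
  have hM : ∀ w, (L₁.trans L₂.symm) w = L₂.symm (L₁ w) := fun w => rfl
  have : y₂ + (L₁.trans L₂.symm) (q - y₁) = q₂ := by
    apply L₂.injective
    rw [map_add, hM, LinearIsometryEquiv.apply_symm_apply, map_sub]
    have e1 : L₂ y₂ = L₁ y₁ + s₁ - s₂ := by rw [hX]; simp
    have e2 : L₂ q₂ = L₁ q + s₁ - s₂ := by rw [← e]; simp
    rw [e1, e2]; abel
  rw [this]; exact hq₂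

/-- **fcc-type junction in physical space.**  In the situation of `shell_transfer_of_patches`, if
the site `y₁ = (k₁,i₁,j₁)` of `X` in `P₁` is fcc-type (`σ₁(k₁−1) = σ₁ k₁`), then its site
`(k₂,i₂,j₂)` in `P₂` is fcc-type and the local fcc lattices agree: `L₁·B(σ₁ k₁) = L₂·B(σ₂ k₂)`. -/
theorem patches_fccType_junction {σ₁ σ₂ : ℤ → ℤ} (hσ₁ : IsHaggSeq σ₁) (hσ₂ : IsHaggSeq σ₂)
    (L₁ L₂ : EuclideanSpace ℝ (Fin 3) ≃ₗᵢ[ℝ] EuclideanSpace ℝ (Fin 3)) (s₁ s₂ : EuclideanSpace ℝ (Fin 3))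
    (k₁ i₁ j₁ k₂ i₂ j₂ : ℤ)
    (hX : L₁ (barlowPos 1 (Real.sqrt (2 / 3)) σ₁ k₁ i₁ j₁) + s₁ =
      L₂ (barlowPos 1 (Real.sqrt (2 / 3)) σ₂ k₂ i₂ j₂) + s₂)
    (hshell : ∀ Q ∈ (fun p => L₁ p + s₁) '' barlowStacking 1 (Real.sqrt (2 / 3)) σ₁,
      dist (L₁ (barlowPos 1 (Real.sqrt (2 / 3)) σ₁ k₁ i₁ j₁) + s₁) Q = 1 →
      Q ∈ (fun p => L₂ p + s₂) '' barlowStacking 1 (Real.sqrt (2 / 3)) σ₂)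
    (hfcc : σ₁ (k₁ - 1) = σ₁ k₁) :
    σ₂ (k₂ - 1) = σ₂ k₂ ∧
      L₁ '' barlowStacking 1 (Real.sqrt (2 / 3)) (fun _ : ℤ => σ₁ k₁) =
        L₂ '' barlowStacking 1 (Real.sqrt (2 / 3)) (fun _ : ℤ => σ₂ k₂) := by
  have htr := shell_transfer_of_patches L₁ L₂ s₁ s₂ _ _ hX hshell
  obtain ⟨h₂, hM⟩ := frame_fccType_of_shell_transfer hσ₁ hσ₂ (L₁.trans L₂.symm) k₁ i₁ j₁ k₂ i₂ j₂
    hfcc htr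
  refine ⟨h₂, ?_⟩
  rw [← hM, Set.image_image]
  exact Set.image_congr fun w _ => by simp

/-- **hcp-type junction in physical space.**  If the site of `X` in `P₁` is hcp-type
(`σ₁(k₁−1) ≠ σ₁ k₁`), then so is its site in `P₂`, and the FRAME CLASSES agree:
`{L₁·Λ₀, L₁·Λ₀⁻} = {L₂·Λ₀, L₂·Λ₀⁻}` (`Λ₀⁻ = B(−1)`), stated as the two possible matchings. -/
theorem patches_hcpType_junction {σ₁ σ₂ : ℤ → ℤ} (hσ₁ : IsHaggSeq σ₁) (hσ₂ : IsHaggSeq σ₂)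
    (L₁ L₂ : EuclideanSpace ℝ (Fin 3) ≃ₗᵢ[ℝ] EuclideanSpace ℝ (Fin 3)) (s₁ s₂ : EuclideanSpace ℝ (Fin 3))
    (k₁ i₁ j₁ k₂ i₂ j₂ : ℤ)
    (hX : L₁ (barlowPos 1 (Real.sqrt (2 / 3)) σ₁ k₁ i₁ j₁) + s₁ =
      L₂ (barlowPos 1 (Real.sqrt (2 / 3)) σ₂ k₂ i₂ j₂) + s₂)
    (hshell : ∀ Q ∈ (fun p => L₁ p + s₁) '' barlowStacking 1 (Real.sqrt (2 / 3)) σ₁,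
      dist (L₁ (barlowPos 1 (Real.sqrt (2 / 3)) σ₁ k₁ i₁ j₁) + s₁) Q = 1 →
      Q ∈ (fun p => L₂ p + s₂) '' barlowStacking 1 (Real.sqrt (2 / 3)) σ₂)
    (hhcp : σ₁ (k₁ - 1) ≠ σ₁ k₁) :
    σ₂ (k₂ - 1) ≠ σ₂ k₂ ∧
      ((L₁ '' fccStacking 1 (Real.sqrt (2 / 3)) = L₂ '' fccStacking 1 (Real.sqrt (2 / 3)) ∧
        L₁ '' barlowStacking 1 (Real.sqrt (2 / 3)) (fun _ : ℤ => (-1 : ℤ)) =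
          L₂ '' barlowStacking 1 (Real.sqrt (2 / 3)) (fun _ : ℤ => (-1 : ℤ))) ∨
       (L₁ '' fccStacking 1 (Real.sqrt (2 / 3)) =
          L₂ '' barlowStacking 1 (Real.sqrt (2 / 3)) (fun _ : ℤ => (-1 : ℤ)) ∧
        L₁ '' barlowStacking 1 (Real.sqrt (2 / 3)) (fun _ : ℤ => (-1 : ℤ)) =
          L₂ '' fccStacking 1 (Real.sqrt (2 / 3)))) := by
  have htr := shell_transfer_of_patches L₁ L₂ s₁ s₂ _ _ hX hshell
  obtain ⟨h₂, -⟩ := hcpType_of_shell_transfer hσ₁ hσ₂ (L₁.trans L₂.symm) k₁ i₁ j₁ k₂ i₂ j₂ hhcp htr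
  obtain ⟨c, hc, hΛ, hΛ'⟩ := frame_hcpType_of_shell_transfer hσ₁ hσ₂ (L₁.trans L₂.symm)
    k₁ i₁ j₁ k₂ i₂ j₂ hhcp htr
  have hLM : ∀ S : Set (EuclideanSpace ℝ (Fin 3)), L₁ '' S = L₂ '' ((L₁.trans L₂.symm) '' S) := by
    intro S
    rw [Set.image_image]
    exact Set.image_congr fun w _ => by simp
  refine ⟨h₂, ?_⟩
  have e1 : fccStacking 1 (Real.sqrt (2 / 3)) = barlowStacking 1 (Real.sqrt (2 / 3)) (fun _ : ℤ => (1 : ℤ)) :=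
    rfl
  rcases hc with rfl | rfl
  · left
    exact ⟨by rw [hLM, hΛ, ← e1], by rw [hLM, hΛ']⟩
  · right
    refine ⟨by rw [hLM, hΛ], ?_⟩
    rw [hLM, hΛ', e1]; simp only [neg_neg]

/-- **The endgame one step up: equal frame classes.**  If grain 1 is captured by the frame class of
`L₁` (`A₁·Λ₀ ∈ {L₁·Λ₀, L₁·Λ₀⁻}`), grain 2 by that of `L₂`, and the two classes agree (either
matching), the pair is co-axial — the literal `∃`-clause of `GenericWallFloor` / `TwoSlabAdhesion`.
With `patches_hcpType_junction` (classes agree across hcp-type junctions) and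
`patches_fccType_junction` (local fcc lattices agree across fcc-type junctions) this closes any
chain of shared shells that never switches the stacking axis. -/
theorem coaxial_of_frameClass_eq
    (A₁ A₂ L₁ L₂ : EuclideanSpace ℝ (Fin 3) ≃ₗᵢ[ℝ] EuclideanSpace ℝ (Fin 3))
    (t₁ t₂ : EuclideanSpace ℝ (Fin 3))
    (h₁ : A₁ '' fccStacking 1 (Real.sqrt (2 / 3)) = L₁ '' fccStacking 1 (Real.sqrt (2 / 3)) ∨
      A₁ '' fccStacking 1 (Real.sqrt (2 / 3)) =
        L₁ '' barlowStacking 1 (Real.sqrt (2 / 3)) (fun _ : ℤ => (-1 : ℤ)))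
    (h₂ : A₂ '' fccStacking 1 (Real.sqrt (2 / 3)) = L₂ '' fccStacking 1 (Real.sqrt (2 / 3)) ∨
      A₂ '' fccStacking 1 (Real.sqrt (2 / 3)) =
        L₂ '' barlowStacking 1 (Real.sqrt (2 / 3)) (fun _ : ℤ => (-1 : ℤ)))
    (hcl : (L₁ '' fccStacking 1 (Real.sqrt (2 / 3)) = L₂ '' fccStacking 1 (Real.sqrt (2 / 3)) ∧
        L₁ '' barlowStacking 1 (Real.sqrt (2 / 3)) (fun _ : ℤ => (-1 : ℤ)) =
          L₂ '' barlowStacking 1 (Real.sqrt (2 / 3)) (fun _ : ℤ => (-1 : ℤ))) ∨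
       (L₁ '' fccStacking 1 (Real.sqrt (2 / 3)) =
          L₂ '' barlowStacking 1 (Real.sqrt (2 / 3)) (fun _ : ℤ => (-1 : ℤ)) ∧
        L₁ '' barlowStacking 1 (Real.sqrt (2 / 3)) (fun _ : ℤ => (-1 : ℤ)) =
          L₂ '' fccStacking 1 (Real.sqrt (2 / 3)))) :
    ∃ (L' : EuclideanSpace ℝ (Fin 3) ≃ₗᵢ[ℝ] EuclideanSpace ℝ (Fin 3))
      (s₁ s₂ : EuclideanSpace ℝ (Fin 3)) (σ σ' : ℤ → ℤ), IsHaggSeq σ ∧ IsHaggSeq σ' ∧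
      (fun p => A₁ p + t₁) '' fccStacking 1 (Real.sqrt (2 / 3)) ⊆
        (fun p => L' p + s₁) '' barlowStacking 1 (Real.sqrt (2 / 3)) σ ∧
      (fun p => A₂ p + t₂) '' fccStacking 1 (Real.sqrt (2 / 3)) ⊆
        (fun p => L' p + s₂) '' barlowStacking 1 (Real.sqrt (2 / 3)) σ' := by
  refine coaxial_of_common_frame A₁ A₂ L₂ t₁ t₂ ?_ h₂
  rcases hcl with ⟨e, e'⟩ | ⟨e, e'⟩
  · rcases h₁ with h | h
    · exact Or.inl (h.trans e)
    · exact Or.inr (h.trans e')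
  · rcases h₁ with h | h
    · exact Or.inr (h.trans e)
    · exact Or.inl (h.trans e')

end Summit.Ventures.Crystal3D.Theorems

end
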